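import Summits.NavierStokesRegularity.NavierStokesRegularity.Theorems.PerpetualPumpCircuitPumpBootLemmas
import Summits.NavierStokesRegularity.NavierStokesRegularity.Theorems.PerpetualPumpCircuitPumpBootClock
import Summits.NavierStokesRegularity.NavierStokesRegularity.Theorems.PerpetualPumpCircuitPumpActiveCore
import Summits.NavierStokesRegularity.NavierStokesRegularity.Theorems.PerpetualPumpCircuitPumpActiveBrackets
import Summits.NavierStokesRegularity.NavierStokesRegularity.Theorems.PerpetualPumpCircuitPumpClockBoxWindow
import Summits.NavierStokesRegularity.NavierStokesRegularity.Theorems.PerpetualPumpCircuitPumpTrailSlaving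
import Summits.NavierStokesRegularity.NavierStokesRegularity.Theorems.PerpetualPumpCircuitPumpPrecursorTower
import Literature.Analysis.ODE.MaximalTime

/-!
# Joint bootstrap (a-priori corridor) of the Toda clock box
# (crux `PerpetualPump.CircuitPump`, stmt-NavierStokesRegularity-1834; line `singular-clock-gspt`,
# sub-goal `toda_boot` of `stub_clockBox`, Toda `m = 2` instance)

For data in the clock box and any solution of the `L`-truncated Toda system on `[0, S]`,
`S ≤ Tmax ≤ 1/8`, the corridor `b₁ ≤ 1/4, b₋₁ ≤ 1, |a₂| ≤ 1` (the environment bounds the active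
block needs) holds throughout, by a continuity induction (`Literature.Analysis.ODE.maximalTimeP`):
`boot_step` recovers each bound with a factor `2` to spare from `toda_active_brackets` /
`toda_active_core` + `activeClock_star` (new bond: Grönwall before `t₃`, no second hop after `t₃`),
`toda_trail_slaving` (spent bond) and `toda_precursor_tower` (precursor carrier), and yields the
Type-I weighted bound `lam^{3n/5} |Z_n| ≤ lam^{3/5}(A₂+3) + 30`. [folklore]
-/

set_option linter.dupNamespace false

noncomputable section

open Set Filter Topology Literature.Analysis.ODE

namespace Summit.NavierStokesRegularity.NavierStokesRegularity.Theorems.PerpetualPumpCircuitPump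

/-- **ONE STEP OF THE JOINT BOOTSTRAP of the Toda clock box.** If the corridor
`b₁ ≤ 1/4 ∧ b₋₁ ≤ 1 ∧ |a₂| ≤ 1` holds on `[0, s]`, `0 < s ≤ Tmax`, for a solution of the `L`-truncated
Toda system (`L ≥ 2`) with data in the clock box, then on `[0, s]` it holds with the improved constants
`1/8, 1/2, 1/2`, and the Type-I weighted bound `lam^{3n/5} |Z_n| ≤ lam^{3/5}(A₂+3) + 30` holds. -/
theorem boot_step :
    ∀ (lam ν q r ε Λ As A₁ A₂ Tmax : ℝ),
    1 < lam → lam ≤ 3 / 2 → ν = lam ^ (4 / 5 : ℝ) → q = lam ^ (1 / 5 : ℝ) → r = lam ^ (-(4 / 5 : ℝ)) →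
    0 < ε → Λ = -Real.log ε → As = (q + 1) * Λ / (2 * (q - 1)) → A₁ = 9 / 10 * As → A₂ = 11 / 10 * As →
    40000 ≤ A₁ → 100000 * (Real.log A₂ + 500) ≤ Λ →
    Tmax = (-Real.log (1 - (((Λ) / 2 + Real.log (A₂ / 8)) + 11 / 5) / A₁) + (250 + 16 * Real.log A₂) / A₁ + (-(1 / ν) * Real.log (1 - ν * ((Λ) / 2 - Real.log q + 73) / (lam * (A₁ - ((Λ) / 2 + Real.log (A₁ / 8)) - 903 - 50 * Real.log A₁))))) →
    ε ≤ 1 / 100000 →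
    (40 * q / A₁ + 4 * ε * 169 * q * Tmax) * Real.exp (65 * Tmax) ≤ 1 / 2 →
    A₂ ^ 2 * ε ^ (3 / 20 : ℝ) ≤ 1 / 2 →
    2 * (40 / A₁ * Real.exp ((65 + 169 / 10 * ε * A₁) * Tmax / (1 - r)) + 4 * ε * 169 * Tmax) ^ 2 *
      Real.exp (130 * Tmax) * Tmax ≤ 13 * (1 - r) →
    40 / A₁ * Real.exp ((65 + 169 / 10 * ε * A₁) * Tmax / (1 - r)) ≤ 1 / 1000 →
    ∀ (L : ℕ) (A s : ℝ) (a b : ℤ → ℝ → ℝ), 2 ≤ L → 0 < s → s ≤ Tmax →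
    a 0 0 = A → A₁ ≤ A → A ≤ A₂ → b 0 0 = Real.sqrt ε → -ε ^ 2 ≤ a 1 0 → a 1 0 ≤ ε ^ (3 / 4 : ℝ) →
    0 ≤ b 1 0 → b 1 0 ≤ ε ^ (3 / 2 : ℝ) → (∀ n : ℤ, 0 ≤ b n 0) →
    (∀ n : ℤ, 2 ≤ n → |a n 0| ≤ ε ^ 2 * (2 * lam) ^ (-(n : ℝ)) ∧
      b n 0 ≤ ε ^ (3 / 2 : ℝ) * (2 * lam) ^ (-(n : ℝ))) →
    (∀ n : ℤ, n ≤ -1 → |a n 0| ≤ 13 * lam ^ (-(n : ℝ) / 5) * (2 - lam ^ ((4 / 5 : ℝ) * n)) ∧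
      b n 0 ≤ 40 / A₁ * lam ^ (-(n : ℝ) / 5) *
        Real.exp ((65 + 169 / 10 * ε * A₁) * Tmax * (1 - lam ^ ((4 / 5 : ℝ) * (n + 1))) / (1 - r))) →
    (∀ n : ℤ, (L : ℤ) < |n| → ∀ t ∈ Set.Icc 0 s, a n t = 0 ∧ b n t = 0) →
    (∀ n : ℤ, |n| ≤ (L : ℤ) → ContinuousOn (a n) (Set.Icc 0 s) ∧ ContinuousOn (b n) (Set.Icc 0 s)) →
    (∀ n : ℤ, |n| ≤ (L : ℤ) → ∀ t ∈ Set.Ico 0 s,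
      HasDerivWithinAt (a n) (-(lam ^ ((4 / 5 : ℝ) * n)) * a n t - lam ^ (n : ℝ) * b n t ^ 2 +
        lam ^ ((n : ℝ) - 1) * b (n - 1) t ^ 2 - ε * lam ^ (n : ℝ) * a n t * b n t) (Set.Ici t) t ∧
      HasDerivWithinAt (b n) (-(lam ^ ((4 / 5 : ℝ) * n)) * b n t +
        lam ^ (n : ℝ) * b n t * (a n t - a (n + 1) t) + ε * lam ^ (n : ℝ) * a n t ^ 2) (Set.Ici t) t) →
    (∀ t ∈ Set.Icc 0 s, b 1 t ≤ 1 / 4 ∧ b (-1) t ≤ 1 ∧ |a 2 t| ≤ 1) →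
    ∀ t ∈ Set.Icc 0 s, (b 1 t ≤ 1 / 8 ∧ b (-1) t ≤ 1 / 2 ∧ |a 2 t| ≤ 1 / 2) ∧
      ∀ n : ℤ, lam ^ ((3 / 5 : ℝ) * n) * |a n t| ≤ lam ^ (3 / 5 : ℝ) * (A₂ + 3) + 30 ∧
        lam ^ ((3 / 5 : ℝ) * n) * |b n t| ≤ lam ^ (3 / 5 : ℝ) * (A₂ + 3) + 30 := by
  intro lam ν q r ε Λ As A₁ A₂ Tmax hlam hlam2 hν hq hr hε hΛ hAs hA₁ hA₂ h40000 HBIG hTmax hε5 HS2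
    HS3 HS5 HSσ L A s a b hL hs0 hsT ha0 hA1 hA2 hb0 ha1l ha1u hb1l hb1u hbnn hprec htrail hvan hcont
    hder hcor t ht
  subst hΛ
  -- (P0) constants and window facts
  obtain ⟨hν1, -, hq1, -, -, -, hr12, hr1, hl35, -⟩ := boot_consts hlam hlam2 hν hq hr
  obtain ⟨-, -, hT8, -, hwin⟩ :=
    toda_clockBox_window lam ν q ε (-Real.log ε) As A₁ A₂ hlam hlam2 hν hq hε rfl hAs hA₁ hA₂ h40000 HBIG
  obtain ⟨hA4, hΛA, hεA, hsεA, hlogA, hlogA2, -, h90, h85, -, -⟩ := hwin A ⟨hA1, hA2⟩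
  rw [← hTmax] at hT8 h90
  clear hwin hTmax hAs hA₂
  have hlam0 : 0 < lam := by linarith only [hlam]
  have hν0 : 0 < ν := by linarith only [hν1]
  have hε1 : ε ≤ 1 := by linarith only [hε5]
  have hA₁0 : 0 < A₁ := by linarith only [h40000]
  have hs8 : s ≤ 1 / 8 := hsT.trans hT8
  have hs2 : s ≤ 1 / 2 := by linarith only [hs8]
  have ht8 : t ≤ 1 / 8 := ht.2.trans hs8
  have hbpos := (toda_trunc_structure lam ε s L a b hlam0 hε.le hs0 hvan hcont hder hbnn).1
  obtain ⟨hcu, hcv, hcw, hcz, hce, hcy, hu', hv', hw', hz'⟩ := toda_boot_sys lam ν ε s L a b hν hL hcont hder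
  have henv_e : ∀ x ∈ Icc 0 s, 0 ≤ b (-1) x ∧ b (-1) x ≤ 1 := fun x hx =>
    ⟨hbpos (-1) x hx, (hcor x hx).2.1⟩
  have henv_y : ∀ x ∈ Icc 0 s, |a 2 x| ≤ 1 := fun x hx => (hcor x hx).2.2
  have hz14 : ∀ x ∈ Icc 0 s, b 1 x ≤ 1 / 4 := fun x hx => (hcor x hx).1
  have henv_z : ∀ x ∈ Icc 0 s, b 1 x ≤ 1 := fun x hx => by linarith only [hz14 x hx]
  -- (P2) active brackets
  have hbr := toda_active_brackets lam ν ε A s (a 0) (b 0) (a 1) (b 1) (b (-1)) (a 2) hlam hlam2 hν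
    hε hs0 hs2 hA4 hΛA hεA hsεA ha0 hb0 ha1l ha1u hb1l hb1u hcu hcv hcw hcz hce hcy hu' hv' hw' hz'
    henv_e henv_y henv_z
  have hu13 : ∀ x ∈ Icc 0 s, -13 ≤ a 0 x := fun x hx => (hbr x hx).1.2.2.1
  -- (P2) trail
  set σb := 40 / A₁ * Real.exp ((65 + 169 / 10 * ε * A₁) * Tmax / (1 - r)) with hσb
  have hTmax0 : 0 ≤ Tmax := hs0.le.trans hsT
  have hK : 0 ≤ (65 + 169 / 10 * ε * A₁) * Tmax := by positivity
  have hσ0 : 0 ≤ σb := by positivity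
  have htd := boot_trail_data (a := a) (b := b) hlam0 hA₁0 hK hr1 htrail
  obtain ⟨hsm1, hsm2⟩ := boot_trail_small hσ0 hε.le hs0.le hsT hr12 HS5
  have htr := toda_trail_slaving lam ε s 13 13 σb L a b hlam (by linarith only [hlam2]) hε.le hε1 hs0
    hs2 (by norm_num) (by norm_num) hσ0 hsm1 hvan hcont hder hbnn hu13 htd
  -- (P2) precursors
  obtain ⟨hM0, hM25, hM12, hM28, hM3, hM18, hε32⟩ := boot_prec_M hlam hlam2 hε hε5 hs0 hs8
  set M := ε ^ 2 + 4 * lam ^ 3 * (1 / 4) ^ 2 * s with hM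
  have h2lam : 0 ≤ 2 * lam := by linarith only [hlam]
  have hpd : ∀ n : ℤ, 2 ≤ n → |a n 0| ≤ ε ^ 2 * (2 * lam) ^ (-(n : ℝ)) ∧
      b n 0 ≤ 1 / 12 * (2 * lam) ^ (-(n : ℝ)) := fun n hn =>
    ⟨(hprec n hn).1, (hprec n hn).2.trans (mul_le_mul_of_nonneg_right hε32
      (Real.rpow_nonneg h2lam _))⟩
  have hpt := toda_precursor_tower lam ε s (ε ^ 2) (1 / 12) (1 / 4) M L a b hlam
    (by linarith only [hlam2]) hε.le hε1 hs0 hs2 (by positivity) (by norm_num) (by norm_num)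
    (by norm_num) hM hM0 hM25 hM12 hM28 hvan hcont hder hbnn hz14 hpd
  -- the point `t`
  obtain ⟨⟨-, hvA, hu13', huA, hw2, hwA, hz0, -⟩, hzg⟩ := hbr t ht
  -- spent bond
  have hbm1 : b (-1) t ≤ 1 / 2 := by
    obtain ⟨-, hb1, -⟩ := htr t ht 1 le_rfl
    simp only [Nat.cast_one] at hb1
    exact boot_bm1 hq (zero_le_one.trans hq1.le) hε.le hA₁0 ht.1 (ht.2.trans hsT)
      (boot_bm1_init hq htrail) hb1 HS2
  -- precursor carrier
  have ha2 : |a 2 t| ≤ 1 / 2 := by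
    obtain ⟨-, -, h2, -⟩ := hpt t ht 2 le_rfl
    have h1 : (2 * lam) ^ (-((2 : ℤ) : ℝ)) ≤ 1 :=
      Real.rpow_le_one_of_one_le_of_nonpos (by linarith only [hlam]) (by norm_num)
    have h3 : 3 * M * (2 * lam) ^ (-((2 : ℤ) : ℝ)) ≤ 3 * M :=
      mul_le_of_le_one_right (by linarith only [hM0]) h1
    linarith only [h2, h3, hM3]
  -- new bond
  set T3 := -Real.log (1 - (-(Real.log ε) / 2 + Real.log (A / 8) + 11 / 5) / A) +
    (250 + 16 * Real.log A) / A with hT3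
  have hz8 : b 1 t ≤ 1 / 8 := by
    by_cases h3 : t ≤ T3
    · exact boot_z_early hlam0 hlam2 hε hε1 rfl hA4 hA2 HS3 h85 ht.1 h3 ht8 hzg
    · push Not at h3
      have ht3s : T3 ≤ s := h3.le.trans ht.2
      obtain ⟨-, ⟨tg, htg1, htg2, -, -, -, hR⟩, hv5, hz3pos, hz3lo, hz3hi⟩ :=
        toda_active_core lam ν ε A s (a 0) (b 0) (a 1) (b 1) (b (-1)) (a 2) hlam hlam2 hν hε hs0 hs2
          hA4 hΛA hεA hsεA ht3s ha0 hb0 ha1l ha1u hb1l hb1u hcu hcv hcw hcz hce hcy hu' hv' hw' hz'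
          henv_e henv_y henv_z
      obtain ⟨hWabs, hT3nn⟩ := toda_boot_W ε A _ tg hε hε1 hA4 hΛA htg1 htg2 hR
      obtain ⟨-, -, -, hWm, hWlo, hWhi, hWp⟩ := activeClock_W hε hA4 hΛA hεA hWabs
      have hIcc : Icc T3 s ⊆ Icc 0 s := Icc_subset_Icc_left hT3nn
      have hW0 : 0 < Real.sqrt ((a 0 T3 - a 1 T3) ^ 2 + 2 * b 0 T3 ^ 2) := by
        linarith only [hWm, hWlo, hA4]
      have hstar := activeClock_star hlam hlam2 hν hε hA4 (h3.trans_le ht.2)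
        (by linarith only [hs8, hT3nn]) hW0 (by linarith only [hWhi, hWp]) (hcw.mono hIcc)
        (hcz.mono hIcc) (hcy.mono hIcc) (fun x hx => hz' x ⟨hT3nn.trans hx.1, hx.2⟩)
        (fun x hx => (hv5 x hx).1) (fun x hx => henv_y x ⟨hT3nn.trans hx.1, hx.2⟩) hz3pos hz3lo t
        ⟨h3.le, ht.2⟩
      obtain ⟨hztpos, -, hzhi⟩ := hstar
      have hG := boot_G hlam0.le hν0 hW0.le hWhi h3.le (ht.2.trans hsT) h90
      exact boot_exp3 hztpos (boot_z_late rfl HBIG hlogA hlogA2 hG hz3hi hzhi)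
  refine ⟨⟨hz8, hbm1, ha2⟩, fun n => ?_⟩
  -- (P5) the weighted bound
  clear hder hcont hvan hu' hv' hw' hz' hcu hcv hcw hcz hce hcy henv_e henv_y henv_z hbr HS2 HS3 HS5
    h90 h85 hzg
  have hA₂3 : 0 ≤ A₂ + 3 := by linarith only [hA1, hA2, hA4]
  have hAA : A + 3 ≤ A₂ + 3 := by linarith only [hA2]
  have hw35 : 0 ≤ lam ^ (3 / 5 : ℝ) := zero_le_one.trans hl35
  have hC0 : 0 ≤ lam ^ (3 / 5 : ℝ) * (A₂ + 3) := mul_nonneg hw35 hA₂3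
  have hCA0 : lam ^ (3 / 5 : ℝ) * (A + 3) ≤ lam ^ (3 / 5 : ℝ) * (A₂ + 3) :=
    mul_le_mul_of_nonneg_left hAA hw35
  have hCA : lam ^ (3 / 5 : ℝ) * (A + 3) ≤ lam ^ (3 / 5 : ℝ) * (A₂ + 3) + 30 := by
    linarith only [hCA0]
  have hCA1 : A + 3 ≤ lam ^ (3 / 5 : ℝ) * (A + 3) :=
    le_mul_of_one_le_left (by linarith only [hA4]) hl35
  have hCA' : A + 3 ≤ lam ^ (3 / 5 : ℝ) * (A₂ + 3) + 30 := hCA1.trans hCA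
  have hC4 : (40000 : ℝ) ≤ lam ^ (3 / 5 : ℝ) * (A₂ + 3) + 30 := by linarith only [hCA', hA4]
  rcases lt_trichotomy n 0 with hn | rfl | hn
  · obtain ⟨j, rfl⟩ : ∃ j : ℕ, n = -(j : ℤ) := ⟨(-n).toNat, by omega⟩
    have hj : 1 ≤ j := by omega
    obtain ⟨hbj0, hbj, haj⟩ := htr t ht j hj
    obtain ⟨haj0, hbj00⟩ := htd j hj
    have hKa : 2 * (σb + 4 * ε * 13 ^ 2 * s) ^ 2 * Real.exp (2 * (4 * 13 + 13) * s) * t ≤ 13 :=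
      (mul_le_mul_of_nonneg_left ht.2 (by positivity)).trans hsm2
    have hw := boot_wt_trail (y := (j : ℝ)) hlam (Nat.cast_nonneg j) ht.1 ht8 hε5 HSσ hKa haj0 haj
      hbj00 hbj0 hbj
    push_cast
    exact ⟨hw.1.trans (by linarith only [hC4]), hw.2.trans (by linarith only [hC4])⟩
  · simp only [Int.cast_zero, mul_zero, Real.rpow_zero, one_mul]
    have hbt0 := hbpos 0 t ht
    refine ⟨(abs_le.mpr ⟨by linarith only [hu13', hA4], huA⟩).trans hCA', ?_⟩
    rw [abs_of_nonneg hbt0]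
    linarith only [hvA, hCA']
  · rcases eq_or_lt_of_le (show (1 : ℤ) ≤ n by omega) with h1 | h2
    · subst h1
      simp only [Int.cast_one, mul_one]
      refine ⟨?_, ?_⟩
      · calc lam ^ (3 / 5 : ℝ) * |a 1 t| ≤ lam ^ (3 / 5 : ℝ) * (A + 3) :=
              mul_le_mul_of_nonneg_left (abs_le.mpr ⟨by linarith only [hw2, hA4], hwA⟩) hw35
          _ ≤ _ := hCA
      · rw [abs_of_nonneg hz0]
        calc lam ^ (3 / 5 : ℝ) * b 1 t ≤ lam ^ (3 / 5 : ℝ) * (A + 3) :=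
              mul_le_mul_of_nonneg_left (by linarith only [hz14 t ht, hA4]) hw35
          _ ≤ _ := hCA
    · have hn2 : (2 : ℤ) ≤ n := by omega
      obtain ⟨hbn0', hbn, han, -⟩ := hpt t ht n hn2
      have hx : (0 : ℝ) ≤ (n : ℝ) := by exact_mod_cast (by omega : (0 : ℤ) ≤ n)
      have hw := boot_wt_prec (x := (n : ℝ)) hlam hx (by linarith only [hM3]) hε.le hε1 hM18 han
        hbn0' hbn (hprec n hn2).2
      exact ⟨hw.1.trans (by linarith only [hC4]), hw.2.trans (by linarith only [hC4])⟩

/-- **JOINT BOOTSTRAP (a-priori corridor) of the Toda clock box.** For data in the box and any solution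
of the `L`-truncated Toda system on `[0,S]`, `S ≤ Tmax`, the three environment bounds the active block
needs (`z ≤ 1/4`, spent bond `≤ 1`, precursor carrier `|a₂| ≤ 1`) hold throughout (continuity induction:
each is recovered with a factor 2 to spare from `toda_active_brackets`/`toda_active_core` + `activeClock_star`,
`toda_trail_slaving`, `toda_precursor_tower` with `(Zb, β) = (1/4, 1/12)`), and consequently the Type-I
weighted bound `lam^{3n/5} |Z| ≤ lam^{3/5}(A₂+3) + 30` (CoveringHyp (0)). -/
theorem toda_boot :
    ∀ (lam ν q r ε Λ As A₁ A₂ Tmax : ℝ),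
    1 < lam → lam ≤ 3 / 2 → ν = lam ^ (4 / 5 : ℝ) → q = lam ^ (1 / 5 : ℝ) → r = lam ^ (-(4 / 5 : ℝ)) →
    0 < ε → Λ = -Real.log ε → As = (q + 1) * Λ / (2 * (q - 1)) → A₁ = 9 / 10 * As → A₂ = 11 / 10 * As →
    40000 ≤ A₁ → 100000 * (Real.log A₂ + 500) ≤ Λ →
    Tmax = (-Real.log (1 - (((Λ) / 2 + Real.log (A₂ / 8)) + 11 / 5) / A₁) + (250 + 16 * Real.log A₂) / A₁ + (-(1 / ν) * Real.log (1 - ν * ((Λ) / 2 - Real.log q + 73) / (lam * (A₁ - ((Λ) / 2 + Real.log (A₁ / 8)) - 903 - 50 * Real.log A₁))))) →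
    ε ≤ 1 / 100000 →
    (40 * q / A₁ + 4 * ε * 169 * q * Tmax) * Real.exp (65 * Tmax) ≤ 1 / 2 →
    A₂ ^ 2 * ε ^ (3 / 20 : ℝ) ≤ 1 / 2 →
    2 * (40 / A₁ * Real.exp ((65 + 169 / 10 * ε * A₁) * Tmax / (1 - r)) + 4 * ε * 169 * Tmax) ^ 2 *
      Real.exp (130 * Tmax) * Tmax ≤ 13 * (1 - r) →
    40 / A₁ * Real.exp ((65 + 169 / 10 * ε * A₁) * Tmax / (1 - r)) ≤ 1 / 1000 →
    q * (ε ^ 2 / (4 * lam ^ 2) + lam * (ε ^ (9 / 20 : ℝ) * A₂ ^ 28 * Real.exp 548) ^ 2 * Tmax + 28 * ε ^ 3 * Tmax) ≤ ε ^ (3 / 4 : ℝ) →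
    18 * ε * (ε ^ 2 + 4 * lam ^ 3 * (ε ^ (9 / 20 : ℝ) * A₂ ^ 28 * Real.exp 548) ^ 2 * Tmax) ^ 2 ≤ ε ^ (3 / 2 : ℝ) →
    ∀ (L : ℕ) (A S : ℝ) (a b : ℤ → ℝ → ℝ), 2 ≤ L → 0 < S → S ≤ Tmax →
    a 0 0 = A → A₁ ≤ A → A ≤ A₂ → b 0 0 = Real.sqrt ε → -ε ^ 2 ≤ a 1 0 → a 1 0 ≤ ε ^ (3 / 4 : ℝ) →
    0 ≤ b 1 0 → b 1 0 ≤ ε ^ (3 / 2 : ℝ) → (∀ n : ℤ, 0 ≤ b n 0) →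
    (∀ n : ℤ, 2 ≤ n → |a n 0| ≤ ε ^ 2 * (2 * lam) ^ (-(n : ℝ)) ∧ b n 0 ≤ ε ^ (3 / 2 : ℝ) * (2 * lam) ^ (-(n : ℝ))) →
    (∀ n : ℤ, n ≤ -1 → |a n 0| ≤ 13 * lam ^ (-(n : ℝ) / 5) * (2 - lam ^ ((4 / 5 : ℝ) * n)) ∧
      b n 0 ≤ 40 / A₁ * lam ^ (-(n : ℝ) / 5) * Real.exp ((65 + 169 / 10 * ε * A₁) * Tmax * (1 - lam ^ ((4 / 5 : ℝ) * (n + 1))) / (1 - r))) →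
    (∀ n : ℤ, (L : ℤ) < |n| → ∀ t ∈ Set.Icc 0 S, a n t = 0 ∧ b n t = 0) → (∀ n : ℤ, |n| ≤ (L : ℤ) → ContinuousOn (a n) (Set.Icc 0 S) ∧ ContinuousOn (b n) (Set.Icc 0 S)) → (∀ n : ℤ, |n| ≤ (L : ℤ) → ∀ t ∈ Set.Ico 0 S, HasDerivWithinAt (a n) (-(lam ^ ((4 / 5 : ℝ) * n)) * a n t - lam ^ (n : ℝ) * b n t ^ 2 + lam ^ ((n : ℝ) - 1) * b (n - 1) t ^ 2 - ε * lam ^ (n : ℝ) * a n t * b n t) (Set.Ici t) t ∧ HasDerivWithinAt (b n) (-(lam ^ ((4 / 5 : ℝ) * n)) * b n t + lam ^ (n : ℝ) * b n t * (a n t - a (n + 1) t) + ε * lam ^ (n : ℝ) * a n t ^ 2) (Set.Ici t) t) →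
    ∀ t ∈ Set.Icc 0 S, b 1 t ≤ 1 / 4 ∧ b (-1) t ≤ 1 ∧ |a 2 t| ≤ 1 ∧
      ∀ n : ℤ, lam ^ ((3 / 5 : ℝ) * n) * |a n t| ≤ lam ^ (3 / 5 : ℝ) * (A₂ + 3) + 30 ∧
        lam ^ ((3 / 5 : ℝ) * n) * |b n t| ≤ lam ^ (3 / 5 : ℝ) * (A₂ + 3) + 30 := by
  intro lam ν q r ε Λ As A₁ A₂ Tmax hlam hlam2 hν hq hr hε hΛ hAs hA₁ hA₂ h40000 HBIG hTmax hε5 HS2 HS3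
    HS5 HSσ _ _ L A S a b hL hS hST ha0 hA1 hA2 hb0 ha1l ha1u hb1l hb1u hbnn hprec htrail hvan hcont hder
  -- one step of the induction (`boot_step` on the restricted solution)
  have step : ∀ s, 0 < s → s ≤ S → (∀ t ∈ Icc 0 s, b 1 t ≤ 1 / 4 ∧ b (-1) t ≤ 1 ∧ |a 2 t| ≤ 1) →
      ∀ t ∈ Icc 0 s, (b 1 t ≤ 1 / 8 ∧ b (-1) t ≤ 1 / 2 ∧ |a 2 t| ≤ 1 / 2) ∧
        ∀ n : ℤ, lam ^ ((3 / 5 : ℝ) * n) * |a n t| ≤ lam ^ (3 / 5 : ℝ) * (A₂ + 3) + 30 ∧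
          lam ^ ((3 / 5 : ℝ) * n) * |b n t| ≤ lam ^ (3 / 5 : ℝ) * (A₂ + 3) + 30 := by
    intro s hs0 hsS hcor
    obtain ⟨hvan', hcont', hder'⟩ := boot_restrict hsS hvan hcont hder
    exact boot_step lam ν q r ε Λ As A₁ A₂ Tmax hlam hlam2 hν hq hr hε hΛ hAs hA₁ hA₂ h40000 HBIG
      hTmax hε5 HS2 HS3 HS5 HSσ L A s a b hL hs0 (hsS.trans hST) ha0 hA1 hA2 hb0 ha1l ha1u hb1l hb1u hbnn
      hprec htrail hvan' hcont' hder' hcor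
  -- the strict corridor at time 0 and the continuity of the three modes
  have hq1 : 1 < q := by rw [hq]; exact Real.one_lt_rpow hlam (by norm_num)
  have hP0 := boot_init hlam hε hε5 (zero_le_one.trans hq1.le) (by linarith) (hS.le.trans hST) hb1u
    (boot_bm1_init hq htrail) (hprec 2 le_rfl).1 HS2
  obtain ⟨-, -, -, hcz, hce, hcy, -⟩ := toda_boot_sys lam ν ε S L a b hν hL hcont hder
  have hcy' : ContinuousOn (fun x => |a 2 x|) (Icc 0 S) := continuous_abs.comp_continuousOn hcy
  -- the continuity induction
  set P : ℝ → Prop := fun t => b 1 t ≤ 1 / 4 ∧ b (-1) t ≤ 1 ∧ |a 2 t| ≤ 1 with hP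
  have hP0' : P 0 := ⟨hP0.1.le, hP0.2.1.le, hP0.2.2.le⟩
  have hclosed : ∀ t ∈ Ioc 0 S, (∀ s ∈ Ico 0 t, P s) → P t := fun t ht h =>
    ⟨boot_closed_le hcz ht fun s hs => (h s hs).1, boot_closed_le hce ht fun s hs => (h s hs).2.1,
      boot_closed_le (f := fun x => |a 2 x|) hcy' ht fun s hs => (h s hs).2.2⟩
  have hTm := maximalTimeP_mem hS.le hP0'
  have hspec : ∀ t ∈ Icc 0 (maximalTimeP P 0 S), P t := fun t ht =>
    maximalTimeP_spec hS.le hP0' hclosed ht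
  have hTS : maximalTimeP P 0 S = S := by
    rcases maximalTimeP_exit hS.le hP0' with h | h
    · exact h
    · exfalso
      apply h
      have himp : b 1 (maximalTimeP P 0 S) < 1 / 4 ∧ b (-1) (maximalTimeP P 0 S) < 1 ∧
          |a 2 (maximalTimeP P 0 S)| < 1 := by
        rcases eq_or_lt_of_le hTm.1 with h0 | h0
        · rw [← h0]; exact hP0
        · obtain ⟨⟨h1, h2, h3⟩, -⟩ := step _ h0 hTm.2 hspec _ ⟨hTm.1, le_rfl⟩
          exact ⟨by linarith, by linarith, by linarith⟩
      exact boot_eventually hTm hcz hce hcy himp.1 himp.2.1 himp.2.2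
  rw [hTS] at hspec
  intro t ht
  exact ⟨(hspec t ht).1, (hspec t ht).2.1, (hspec t ht).2.2, (step S hS le_rfl hspec t ht).2⟩

end Summit.NavierStokesRegularity.NavierStokesRegularity.Theorems.PerpetualPumpCircuitPump
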